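import Literature.Computability.Complexity.BoolEncodings
import Literature.Computability.Complexity.Promise
import Literature.Computability.Complexity.CNF
import HarnessLib

/-!
# Gap (exact) Set Cover and its NP-hardness for every constant factor

Topic `Computability/Complexity`, namespace `Literature.Computability.Complexity` (with
`SetCoverInstance`, `GapSetCover` sub-namespaces for the instance API and the YES/NO sets).
Vendored as the INPUT of Khot's Thm. 3.1 (J. ACM 52 (2005); the PCP-based brick `F1` of the
decomposition of `Literature.Algebra.EuclideanLattices.gapSVP_const_isNPHardRandomized`, see
`Literature/Algebra/EuclideanLattices/KhotSVPHardness.lean`): "It is known that, for any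
constant `η > 0`, there is a polynomial-time reduction from SAT to the Set Cover problem such
that if the SAT instance is a YES instance, then there are `ηd` sets that cover each element
of the universe exactly once; if the SAT instance is a NO instance, then there is no set-cover
of size `d`" — which is Arora–Babai–Stern–Sweedyk 1997, Prop. 6, there attributed to
Bellare–Goldwasser–Lund–Russell (STOC 1993), with `K = ηd`, `c = 1/η`.

## Contents

* `SetCoverInstance` — a ground set `U = {0, …, univSize - 1}`, a list of subsets
  `S₀, …, S_{m-1}` (lists of naturals; members `≥ univSize` are outside the ground set and
  ignored by the cover predicates) and the integer `K`; `IsCover` ("a subcollection of the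
  `Sᵢ`'s whose union is `U`"), `IsExactCover` (every element of `U` lies in exactly one chosen
  set — "the cover is said to be exact if the sets in the cover are pairwise disjoint"), the
  Boolean `encoding` (numbers in binary, lists as `listBool` codes, as `CSPInstance.encoding`).
* `gapSetCover c : PromiseProblem` — YES: some exact cover has size `K` (and `K ≥ 1`); NO: every
  set cover has size at least `c · K`; disjoint for `c > 1` (`gapSetCover_disjoint`).
* the named fact `AroraEtAl1997_prop6` — for every `c > 1`, (SAT, UNSAT) Karp-reduces to
  `gapSetCover c`.

## Faithfulness notes

* Printed (ABSS 1997, Prop. 6, p. 319): "For every `c > 1` there is a polynomial time reduction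
  that, given an instance `φ` of SAT, produces an instance of set-cover and integer `K` with the
  following property: If `φ` is satisfiable, there is an exact cover of size `K`, and otherwise
  no set cover has size less than `c · K`." Rendered as a `PromiseProblem.PolyTimeReducible`
  from the promise problem (codes of satisfiable CNFs, codes of unsatisfiable CNFs) — the
  printed "instance `φ` of SAT" is a CNF formula; non-codewords are off the promise — to
  `gapSetCover c`, for rational `c > 1` (only the order of `c · K` against integers matters).
* `K ≥ 1` is made explicit on the YES side: with `K = 0` the empty instance would be both a YES
  instance (the empty exact cover) and a NO instance (vacuously), and a constant map would
  "prove" the fact; every instance produced from a formula has `K ≥ 1` (a nonempty ground set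
  needs a nonempty cover), so nothing printed is lost. With it, YES and NO are disjoint for
  `c > 1` (the exact cover itself is a cover of size `K < cK`).
* This is a consequence of the PCP theorem (BGLR 1993 build on Arora–Safra / ALMSS and the
  Lund–Yannakakis set-cover reduction); it is vendored as a named fact, not proved.
* Mathlib has no set-cover material (searched `SetCover`, `setCover`, `exact cover`); the tree
  has `gapE3SAT` (`Approximation.lean`) and `gapCSP` (`GapCSP.lean`) in the same style; nothing
  is duplicated.

## References

* S. Arora, L. Babai, J. Stern, Z. Sweedyk, *The hardness of approximate optima in lattices,
  codes, and systems of linear equations*, J. Comput. Syst. Sci. 54 (1997) 317–331, Prop. 6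
  (p. 319) and the proof of Thm. 5.
* M. Bellare, S. Goldwasser, C. Lund, A. Russell, *Efficient probabilistically checkable proofs
  and applications to approximations*, Proc. 25th STOC (1993) 294–304.
* S. Khot, *Hardness of approximating the shortest vector problem in lattices*, J. ACM 52
  (2005), Thm. 3.1 (proof).
-/

namespace Literature.Computability.Complexity

open _root_.Computability

/-! ### Set cover instances -/

/-- An instance of (gap, exact) SET COVER: the ground set `U = {0, …, univSize - 1}`, the
subsets `S₀, …, S_{m-1}` of `U` (as lists of naturals; members `≥ univSize` lie outside the
ground set and play no role), and the integer `K` of ABSS 1997, Prop. 6 ("an instance of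
set-cover consists of a ground-set `U` and a collection of subsets `S₁, S₂, …, S_m` of `U`").
[cite: AroraEtAl1997, Prop. 6 (p. 319)] -/
structure SetCoverInstance where
  /-- The size of the ground set `U = {0, …, univSize - 1}`. -/
  univSize : ℕ
  /-- The subsets `S₀, …, S_{m-1}`, as lists of naturals. -/
  sets : List (List ℕ)
  /-- The size parameter `K`. -/
  K : ℕ

namespace SetCoverInstance

/-- The `j`-th subset `S_j` (empty for `j ≥ m`). [cite: AroraEtAl1997, Prop. 6 (p. 319)] -/
def subsetAt (I : SetCoverInstance) (j : ℕ) : List ℕ :=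
  I.sets.getD j []

/-- `T` (a set of indices `< m`) is a COVER: "a subcollection of the `Sᵢ`'s whose union is `U`"
— every element of the ground set lies in some chosen subset. [cite: AroraEtAl1997, Prop. 6 (p. 319)] -/
def IsCover (I : SetCoverInstance) (T : Finset ℕ) : Prop :=
  (∀ j ∈ T, j < I.sets.length) ∧ ∀ e < I.univSize, ∃ j ∈ T, e ∈ I.subsetAt j

/-- `T` is an EXACT COVER: every element of the ground set lies in exactly one chosen subset
("the cover is said to be exact if the sets in the cover are pairwise disjoint" — on the
ground set; Khot 2005, Thm. 3.1: "sets that cover each element of the universe exactly once").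
[cite: AroraEtAl1997, Prop. 6 (p. 319)] -/
def IsExactCover (I : SetCoverInstance) (T : Finset ℕ) : Prop :=
  (∀ j ∈ T, j < I.sets.length) ∧ ∀ e < I.univSize, (T.filter fun j => e ∈ I.subsetAt j).card = 1

/-- An exact cover is a cover. [cite: AroraEtAl1997, Prop. 6 (p. 319)] -/
theorem IsExactCover.isCover {I : SetCoverInstance} {T : Finset ℕ} (h : I.IsExactCover T) :
    I.IsCover T := by
  refine ⟨h.1, fun e he => ?_⟩
  have hcard := h.2 e he
  obtain ⟨j, hj⟩ := Finset.card_pos.1 (by omega : 0 < (T.filter fun j => e ∈ I.subsetAt j).card)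
  exact ⟨j, (Finset.mem_filter.1 hj).1, (Finset.mem_filter.1 hj).2⟩

/-! ### Boolean encoding of instances -/

/-- The instance as the tuple `(|U|, [S_j]_j, K)`. [folklore] -/
def toTuple (I : SetCoverInstance) : ℕ × List (List ℕ) × ℕ :=
  (I.univSize, I.sets, I.K)

/-- The instance with tuple `(|U|, [S_j]_j, K)`. [folklore] -/
def ofTuple (t : ℕ × List (List ℕ) × ℕ) : SetCoverInstance :=
  ⟨t.1, t.2.1, t.2.2⟩

/-- `ofTuple` inverts `toTuple`. [folklore] -/
@[simp] theorem ofTuple_toTuple (I : SetCoverInstance) : ofTuple I.toTuple = I := rfl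

/-- `toTuple` inverts `ofTuple`. [folklore] -/
@[simp] theorem toTuple_ofTuple (t : ℕ × List (List ℕ) × ℕ) : (ofTuple t).toTuple = t := rfl

/-- The Boolean encoding of the tuple `(|U|, [S_j]_j, K)` (numbers in binary, lists as
`listBool` codes). [folklore] -/
def tupleEncoding : Encoding (ℕ × List (List ℕ) × ℕ) Bool :=
  encodingNatBool.pairBool (encodingNatBool.listBool.listBool.pairBool encodingNatBool)

/-- The Boolean encoding of set cover instances (through `toTuple`/`ofTuple` and
`tupleEncoding`). [folklore] -/
def encoding : Encoding SetCoverInstance Bool where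
  encode I := tupleEncoding.encode I.toTuple
  decode v := (tupleEncoding.decode v).map ofTuple
  decode_encode I := by simp [tupleEncoding.decode_encode]

/-- The encoding of an instance is the tuple code (definitional). [folklore] -/
theorem encoding_encode (I : SetCoverInstance) :
    encoding.encode I = tupleEncoding.encode I.toTuple := rfl

end SetCoverInstance

/-! ### The gap problem -/

namespace GapSetCover

/-- YES instances of gap set cover: "there is an exact cover of size `K`" (and `K ≥ 1`, see the
module docstring: this only excludes the empty instance with `K = 0`, which no formula is
mapped to, and makes YES/NO disjoint). [cite: AroraEtAl1997, Prop. 6 (p. 319)] -/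
def yesSet : Set SetCoverInstance :=
  {I | 0 < I.K ∧ ∃ T : Finset ℕ, I.IsExactCover T ∧ T.card = I.K}

/-- NO instances of gap set cover with factor `c`: "no set cover has size less than `c · K`".
[cite: AroraEtAl1997, Prop. 6 (p. 319)] -/
def noSet (c : ℚ) : Set SetCoverInstance :=
  {I | ∀ T : Finset ℕ, I.IsCover T → c * I.K ≤ T.card}

/-- For `c > 1` the YES and NO instances are disjoint: an exact cover of size `K ≥ 1` is a
cover of size `K < c · K`. [cite: AroraEtAl1997, Prop. 6 (p. 319)] -/
theorem disjoint_yesSet_noSet {c : ℚ} (hc : 1 < c) : Disjoint yesSet (noSet c) := by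
  refine Set.disjoint_left.2 ?_
  rintro I ⟨hK, T, hT, hcard⟩ hno
  have h := hno T hT.isCover
  rw [hcard] at h
  have hK' : (0 : ℚ) < I.K := by exact_mod_cast hK
  nlinarith

end GapSetCover

/-- The promise problem **gap (exact) set cover with factor `c`** over `{0,1}`: YES instances
are the codes of `GapSetCover.yesSet` (an exact cover of size `K ≥ 1` exists), NO instances
the codes of `GapSetCover.noSet c` (every cover has size `≥ c · K`), under
`SetCoverInstance.encoding`. [cite: AroraEtAl1997, Prop. 6 (p. 319)] -/
def gapSetCover (c : ℚ) : PromiseProblem :=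
  PromiseProblem.ofEncoding SetCoverInstance.encoding GapSetCover.yesSet (GapSetCover.noSet c)

/-- The yes-part of `gapSetCover c` (definitional). [cite: AroraEtAl1997, Prop. 6 (p. 319)] -/
@[simp] theorem gapSetCover_yes (c : ℚ) :
    (gapSetCover c).yes = SetCoverInstance.encoding.toLanguage GapSetCover.yesSet := rfl

/-- The no-part of `gapSetCover c` (definitional). [cite: AroraEtAl1997, Prop. 6 (p. 319)] -/
@[simp] theorem gapSetCover_no (c : ℚ) :
    (gapSetCover c).no = SetCoverInstance.encoding.toLanguage (GapSetCover.noSet c) := rfl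

/-- For `c > 1`, `gapSetCover c` is a genuine (disjoint) promise problem.
[cite: AroraEtAl1997, Prop. 6 (p. 319)] -/
theorem gapSetCover_disjoint {c : ℚ} (hc : 1 < c) : (gapSetCover c).Disjoint :=
  PromiseProblem.disjoint_ofEncoding _ (GapSetCover.disjoint_yesSet_noSet hc)

/-- The promise problem (SAT, UNSAT): YES = codes of satisfiable CNF formulas (the language
`SAT`), NO = codes of unsatisfiable ones (the language `UNSAT`); non-codewords are off the
promise. This is the source side of reductions stated "given an instance `φ` of SAT".
[cite: AroraBarak2009, §2.6.1] -/
def satUnsatPromise : PromiseProblem :=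
  PromiseProblem.ofEncoding encodingCNF {φ : CNF ℕ | φ.Satisfiable} {φ : CNF ℕ | ¬φ.Satisfiable}

/-- The yes-part of `satUnsatPromise` is `SAT`. [cite: AroraBarak2009, §2.6.1] -/
@[simp] theorem satUnsatPromise_yes : satUnsatPromise.yes = SAT := rfl

/-- The no-part of `satUnsatPromise` is `UNSAT`. [cite: AroraBarak2009, §2.6.1] -/
@[simp] theorem satUnsatPromise_no : satUnsatPromise.no = UNSAT := rfl

/-- `satUnsatPromise` is disjoint (`SAT_disjoint_UNSAT`). [cite: AroraBarak2009, §2.6.1] -/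
theorem satUnsatPromise_disjoint : satUnsatPromise.Disjoint :=
  SAT_disjoint_UNSAT

/-- **Arora–Babai–Stern–Sweedyk 1997, Prop. 6 (attributed there to Bellare–Goldwasser–Lund–
Russell, STOC 1993): gap exact set cover is NP-hard for every constant factor.** "For every
`c > 1` there is a polynomial time reduction that, given an instance `φ` of SAT, produces an
instance of set-cover and integer `K` with the following property: If `φ` is satisfiable,
there is an exact cover of size `K`, and otherwise no set cover has size less than `c · K`."
Rendered: for every rational `c > 1`, the promise problem (SAT, UNSAT) Karp-reduces
(`PromiseProblem.PolyTimeReducible`: one `FP` function mapping YES to YES and NO to NO) to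
`gapSetCover c`. A consequence of the PCP theorem; the input of Khot 2005, Thm. 3.1 with
`K = ηd`, `c = 1/η`. Named fact, not proved here. [cite: AroraEtAl1997, Prop. 6 (p. 319)] -/
def AroraEtAl1997_prop6 : Prop :=
  ∀ c : ℚ, 1 < c → satUnsatPromise.PolyTimeReducible (gapSetCover c)

end Literature.Computability.Complexity
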